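import Mathlib
import Summits.Ventures.HodgeRepro.Tier4.Target
import Summits.Ventures.HodgeRepro.Tier4.Line3.Defs
import Summits.Ventures.HodgeRepro.Tier4.Line3.DefsLemmas
import Summits.Ventures.HodgeRepro.Tier4.Line3.CopyRemainder
import Summits.Ventures.HodgeRepro.Tier4.Line3.LatticeGaussSummable

/-!
# Tier4/Line3/CopyCountSummable — the count over the copies is SUMMABLE when the scalars are integral and the
majorant is Gaussian in their archimedean sizes

Blind re-derivation cell `pub-hodge-repro`, Tier 4 «PROVE THE STEP», LINE L3, seat t4-x2 (g3, reserve wall-breaker); the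
`Summable` half of v0.44's pure count `MajorantCount S xm W θ₁` (bus S13913: `Summable (fun o => if o ∈ Copies S xm ∧ o ≠ main
then W o else 0) ∧ Σ' … ≤ θ₁`), proved for EVERY admissible set of INTEGRAL scalar tuples (`IntegralScalars S`: the natural
`S` — integral, prime to the bad places — qualifies) and every non-negative majorant dominated by a Gaussian in the mixed
norms of the scalars (`‖mixedEmbedding X.E (rep o j)‖` = the house of `rep o j`):

  `summable_copyCount_of_gauss`: `W o ≤ C · exp(−κ Σ_j ‖mixedEmbedding X.E (c.rep o j)‖²)` on the copies, `κ > 0`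
  ⟹ `Summable (fun o => if o ∈ Copies S xm ∧ o ≠ main then W o else 0)`.

The copies are indexed injectively by their representative tuples of algebraic integers (`CopyData.rep_orbit`), and the
Gaussian is summable over `Fin 4 → 𝓞 E` (LatticeGaussSummable `summable_gauss_mixedNorm_sq_tuple`, from the `ℤ`-lattice
structure of the mixed embedding).  What remains displayed in `MajorantCount` after this is the INEQUALITY `Σ' ≤ θ₁` — the
profile condition of the centre (bus S13860 (F2)) — and, for the majorant `shrinkMaj A k · ‖Λ‖` of CopyWeightBoundShrink,
the Gaussian domination itself (deep balanced centre + sub-Gaussian phases), which is a separate statement.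

Nothing here says anything about the status of the Hodge conjecture for CM abelian varieties, which is NOT proved
(HC_CM is NOT proved by anyone in this repository).
-/

set_option autoImplicit false

noncomputable section

namespace Summit.Ventures.HodgeRepro.Tier4.Line3

open Summit.Ventures.HodgeRepro.Tier4
open NumberField
open scoped Classical

namespace T4Data

variable (X : T4Data)

/-- The admissible scalar tuples are tuples of algebraic integers. -/
def IntegralScalars (S : Set (Fin 4 → X.E)) : Prop := ∀ ε ∈ S, ∀ j, IsIntegral ℤ (ε j)

/-- The non-main copies as a set of orbits. -/
def NonMainCopies (S : Set (Fin 4 → X.E)) (xm : X.Tuple) : Set X.Orbit :=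
  {o | o ∈ X.Copies S xm ∧ o ≠ X.orbitOf (X.lines xm)}

/-- The representative tuple of a copy, as a tuple of algebraic integers (integral admissible scalars). -/
def CopyData.intRep {X : T4Data} {D : X.ThetaData} {S : Set (Fin 4 → X.E)} {xm : X.Tuple} (c : X.CopyData D S xm)
    (hS : X.IntegralScalars S) (o : X.NonMainCopies S xm) : Fin 4 → 𝓞 X.E :=
  fun j => ⟨c.rep o.1 j, hS _ (c.rep_mem o.1 o.2.1) j⟩

/-- The integral representative is injective on the non-main copies (`rep_orbit`). -/
theorem CopyData.intRep_injective {X : T4Data} {D : X.ThetaData} {S : Set (Fin 4 → X.E)} {xm : X.Tuple}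
    (c : X.CopyData D S xm) (hS : X.IntegralScalars S) : Function.Injective (c.intRep hS) := by
  intro o o' h
  have hrep : c.rep o.1 = c.rep o'.1 := by
    funext j
    have := congrArg (fun f : Fin 4 → 𝓞 X.E => ((f j : 𝓞 X.E) : X.E)) h
    simpa [CopyData.intRep] using this
  apply Subtype.ext
  rw [← c.rep_orbit o.1 o.2.1, ← c.rep_orbit o'.1 o'.2.1, hrep]

/-- **THE COUNT OVER THE COPIES IS SUMMABLE** for integral admissible scalars and a non-negative majorant dominated by a
Gaussian in the mixed norms of the representatives. -/
theorem summable_copyCount_of_gauss {D : X.ThetaData} {S : Set (Fin 4 → X.E)} {xm : X.Tuple} (c : X.CopyData D S xm)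
    (hS : X.IntegralScalars S) (W : X.Orbit → ℝ) (hW0 : ∀ o, 0 ≤ W o) {C κ : ℝ} (hκ : 0 < κ)
    (hW : ∀ o ∈ X.Copies S xm, o ≠ X.orbitOf (X.lines xm) →
      W o ≤ C * Real.exp (-(κ * ∑ j, ‖mixedEmbedding X.E (c.rep o j)‖ ^ 2))) :
    Summable fun o => if o ∈ X.Copies S xm ∧ o ≠ X.orbitOf (X.lines xm) then W o else 0 := by
  -- the Gaussian on integral tuples, pulled back along the injective representative
  have hG : Summable fun ε : Fin 4 → 𝓞 X.E => C * Real.exp (-(κ * ∑ j, ‖mixedEmbedding X.E (ε j : X.E)‖ ^ 2)) :=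
    (summable_gauss_mixedNorm_sq_tuple hκ).mul_left C
  have hGι := hG.comp_injective (c.intRep_injective hS)
  -- the majorant on the subtype of non-main copies
  have hsub : Summable fun o : X.NonMainCopies S xm => W o.1 := by
    refine Summable.of_nonneg_of_le (fun o => hW0 o.1) (fun o => ?_) hGι
    have := hW o.1 o.2.1 o.2.2
    simpa [Function.comp_apply, CopyData.intRep] using this
  -- from the subtype to the indicator, and the indicator is the `ite`
  have hind : Summable ((X.NonMainCopies S xm).indicator W) := summable_subtype_iff_indicator.1 hsub
  refine hind.congr fun o => ?_
  simp only [Set.indicator_apply, NonMainCopies, Set.mem_setOf_eq]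

end T4Data

end Summit.Ventures.HodgeRepro.Tier4.Line3

end
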